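import Mathlib
import HarnessLib

/-!
# Zhang (2022), §16 (16.10): growth lemmas for the sizes of the campaign parameters on Landau's contour

Topic `Literature/NumberTheory/LFunctions/Zhang2022` (Landau–Siegel audit tree; verdict-neutral).
Y. Zhang, *Discrete mean estimates and the Landau–Siegel zero*, arXiv:2211.02515v1 (2022)
[Zhang2022LandauSiegel] — **an unrefereed manuscript under adjudication**; nothing here asserts its
Theorems 1–2. This file is pure real analysis, used by `Section16Eq1610` to turn the explicit remainder
of the contour shift behind (16.10) [Z22 p.92, tex L4550] (tails and horizontal sides carry the Gaussian
`exp{−(H−1)²/(4𝓛³⁰)}`, `H = 𝓛²⁰`, against factors `≤ e^{2𝓛⁹+2}·poly(𝓛)`; the left side carries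
`(d/P₄)^{η} ≤ T^{−18η} = exp{−(9c/4)𝓛^{1/10}}`; the exceptional-zero residue carries `𝓛¹⁹⁻²⁰²²`) into
one bound `O(𝓛⁻²⁰⁰⁰)`:

* `rpow_le_exp_mul_rpow` — `L^k ≤ exp(κL^ε)` for `L ≥ L₀(k,κ,ε)` (`k ≥ 0`, `κ, ε > 0`);
* `log_pow_twenty_add_le` — `log(L²⁰ + 8) ≤ κL` for `L ≥ L₀(κ)`;
* `gauss_budget_le_one` — `L²⁶⁰⁰·e^{2L⁹+2}·e^{−(L²⁰−1)²/(4L³⁰)} ≤ 1` for `L ≥ L₀`.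

## References

* Y. Zhang, arXiv:2211.02515v1 (2022), §16 (16.10) p.92; §8 proof of Lemma 8.2 p.44.
  [cite: Zhang2022LandauSiegel, §16 (16.10) p.92]
-/

noncomputable section

open Real

namespace Literature.NumberTheory.LFunctions.Zhang2022.Eq1610

/-- **Powers are eventually below stretched exponentials**: for `k ≥ 0`, `κ > 0`, `ε > 0` there is
`L₀ ≥ 1` with `L^k ≤ exp(κ·L^ε)` for all `L ≥ L₀` (`k log L ≤ (2k/ε)L^{ε/2} ≤ κL^ε` once
`L^{ε/2} ≥ 2k/(εκ)`). [cite: Zhang2022LandauSiegel, §16 (16.10) p.92] -/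
theorem rpow_le_exp_mul_rpow {k κ ε : ℝ} (hk : 0 ≤ k) (hκ : 0 < κ) (hε : 0 < ε) :
    ∃ L₀ : ℝ, 1 ≤ L₀ ∧ ∀ L : ℝ, L₀ ≤ L → L ^ k ≤ Real.exp (κ * L ^ ε) := by
  set M : ℝ := 2 * k / (ε * κ) with hM
  have hM0 : 0 ≤ M := by positivity
  refine ⟨max 1 (M ^ (2 / ε)), le_max_left _ _, fun L hL => ?_⟩
  have hL1 : 1 ≤ L := le_trans (le_max_left _ _) hL
  have hL0 : 0 < L := by linarith
  have hLM : M ^ (2 / ε) ≤ L := le_trans (le_max_right _ _) hL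
  -- `M ≤ L^{ε/2}`
  have hε2 : 0 < ε / 2 := by positivity
  have hMle : M ≤ L ^ (ε / 2) := by
    have h := Real.rpow_le_rpow (Real.rpow_nonneg hM0 _) hLM hε2.le
    rwa [← Real.rpow_mul hM0, show 2 / ε * (ε / 2) = 1 by field_simp, Real.rpow_one] at h
  -- `k log L ≤ κ L^ε`
  have hlog : Real.log L ≤ L ^ (ε / 2) / (ε / 2) := Real.log_le_rpow_div hL0.le hε2
  have hlogL : 0 ≤ Real.log L := Real.log_nonneg hL1
  have hpow_half : 0 ≤ L ^ (ε / 2) := Real.rpow_nonneg hL0.le _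
  have hkey : k * Real.log L ≤ κ * L ^ ε := by
    have h1 : k * Real.log L ≤ k * (L ^ (ε / 2) / (ε / 2)) := mul_le_mul_of_nonneg_left hlog hk
    have h2 : k * (L ^ (ε / 2) / (ε / 2)) = κ * M * L ^ (ε / 2) := by
      rw [hM]; field_simp
    have h3 : κ * M * L ^ (ε / 2) ≤ κ * L ^ (ε / 2) * L ^ (ε / 2) := by
      have := mul_le_mul_of_nonneg_right hMle hpow_half
      nlinarith
    have h4 : L ^ (ε / 2) * L ^ (ε / 2) = L ^ ε := by
      rw [← Real.rpow_add hL0]; ring_nf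
    calc k * Real.log L ≤ κ * M * L ^ (ε / 2) := by rw [← h2]; exact h1
      _ ≤ κ * L ^ (ε / 2) * L ^ (ε / 2) := h3
      _ = κ * L ^ ε := by rw [mul_assoc, h4]
  rw [Real.rpow_def_of_pos hL0, mul_comm]
  exact Real.exp_le_exp.mpr hkey

/-- **`log(L²⁰ + 8) ≤ κL` eventually**: for `κ > 0` and `L ≥ max 4 (41/κ)²`,
`log(L²⁰ + 8) ≤ 1 + 20 log L ≤ 1 + 40√L ≤ κL`. [cite: Zhang2022LandauSiegel, §16 (16.10) p.92] -/
theorem log_pow_twenty_add_le {κ : ℝ} (hκ : 0 < κ) {L : ℝ} (hL : max 4 ((41 / κ) ^ 2) ≤ L) :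
    Real.log (L ^ 20 + 8) ≤ κ * L := by
  have hL4 : 4 ≤ L := le_trans (le_max_left _ _) hL
  have hL0 : 0 < L := by linarith
  have hLκ : (41 / κ) ^ 2 ≤ L := le_trans (le_max_right _ _) hL
  -- `L²⁰ + 8 ≤ 2L²⁰`
  have hpow : 8 ≤ L ^ 20 := by
    have : (4 : ℝ) ^ 20 ≤ L ^ 20 := pow_le_pow_left₀ (by norm_num) hL4 20
    nlinarith
  have h1 : Real.log (L ^ 20 + 8) ≤ Real.log 2 + 20 * Real.log L := by
    have h := Real.log_le_log (by positivity : 0 < L ^ 20 + 8) (by linarith : L ^ 20 + 8 ≤ 2 * L ^ 20)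
    rw [Real.log_mul (by norm_num) (by positivity), Real.log_pow] at h
    push_cast at h
    linarith
  have hlog2 : Real.log 2 ≤ 1 := by
    rw [Real.log_le_iff_le_exp (by norm_num)]
    linarith [Real.add_one_le_exp (1 : ℝ)]
  -- `log L ≤ 2√L`
  have hsqrt : Real.log L ≤ 2 * Real.sqrt L := by
    have h := Real.log_le_rpow_div hL0.le (by norm_num : (0 : ℝ) < 1 / 2)
    rw [← Real.sqrt_eq_rpow] at h
    linarith
  -- `√L ≥ 41/κ`
  have hsq : 41 / κ ≤ Real.sqrt L := by
    rw [show (41 : ℝ) / κ = Real.sqrt ((41 / κ) ^ 2) by rw [Real.sqrt_sq (by positivity)]]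
    exact Real.sqrt_le_sqrt hLκ
  have hsqrt1 : 1 ≤ Real.sqrt L := by
    rw [show (1 : ℝ) = Real.sqrt 1 by simp]; exact Real.sqrt_le_sqrt (by linarith)
  have hsqL : Real.sqrt L * Real.sqrt L = L := Real.mul_self_sqrt hL0.le
  have hκsq : 41 ≤ κ * Real.sqrt L := by
    have := mul_le_mul_of_nonneg_left hsq hκ.le
    rwa [mul_div_cancel₀ _ hκ.ne'] at this
  calc Real.log (L ^ 20 + 8) ≤ 1 + 20 * (2 * Real.sqrt L) := by nlinarith
    _ = 1 + 40 * Real.sqrt L := by ring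
    _ ≤ 41 * Real.sqrt L := by linarith
    _ ≤ κ * Real.sqrt L * Real.sqrt L := by nlinarith [Real.sqrt_nonneg L]
    _ = κ * L := by rw [mul_assoc, hsqL]

/-- **The Gaussian budget of the tails and the horizontal sides**: there is `L₀` such that for
`L ≥ L₀`, `L²⁶⁰⁰·e^{2L⁹+2}·e^{−(L²⁰−1)²/(4L³⁰)} ≤ 1` (`(L²⁰−1)² ≥ L⁴⁰/2`, so the exponent is
`≤ 2L⁹ + 2 − L¹⁰/8 ≤ −L¹⁰/16`, and `L²⁶⁰⁰ ≤ e^{L¹⁰/16}`). With `H = 𝓛²⁰`, `Λ = 𝓛³⁰` this is why the pieces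
of Landau's contour at height `±H` and the tails are negligible against `P₄, d ≤ e^{𝓛⁹}` factors.
[cite: Zhang2022LandauSiegel, §16 (16.10) p.92] -/
theorem gauss_budget_le_one : ∃ L₀ : ℝ, 3 ≤ L₀ ∧ ∀ L : ℝ, L₀ ≤ L →
    L ^ (2600 : ℝ) * Real.exp (2 * L ^ 9 + 2) * Real.exp (-(L ^ 20 - 1) ^ 2 / (4 * L ^ 30)) ≤ 1 := by
  obtain ⟨L₁, hL₁, hG⟩ := rpow_le_exp_mul_rpow (k := 2600) (κ := 1 / 16) (ε := 10) (by norm_num)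
    (by norm_num) (by norm_num)
  refine ⟨max 64 L₁, le_trans (by norm_num) (le_max_left _ _), fun L hL => ?_⟩
  have hL64 : 64 ≤ L := le_trans (le_max_left _ _) hL
  have hLL₁ : L₁ ≤ L := le_trans (le_max_right _ _) hL
  have hL0 : 0 < L := by linarith
  -- `(L²⁰ − 1)² ≥ L⁴⁰/2`
  have h20 : 4 ≤ L ^ 20 := by
    have : (64 : ℝ) ^ 20 ≤ L ^ 20 := pow_le_pow_left₀ (by norm_num) hL64 20
    nlinarith
  have hsq : L ^ 40 / 2 ≤ (L ^ 20 - 1) ^ 2 := by nlinarith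
  -- the exponent
  have h30 : 0 < 4 * L ^ 30 := by positivity
  have hexp1 : -(L ^ 20 - 1) ^ 2 / (4 * L ^ 30) ≤ -(L ^ 10 / 8) := by
    rw [neg_div, neg_le_neg_iff, le_div_iff₀ h30]
    have : L ^ 40 = L ^ 10 * L ^ 30 := by ring
    nlinarith
  have hexp2 : 2 * L ^ 9 + 2 + -(L ^ 10 / 8) ≤ -(L ^ 10 / 16) := by
    have h9 : 1 ≤ L ^ 9 := one_le_pow₀ (by linarith)
    have h10 : L ^ 10 = L * L ^ 9 := by ring
    have h64 : 64 * L ^ 9 ≤ L * L ^ 9 := mul_le_mul_of_nonneg_right hL64 (by linarith)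
    rw [h10]
    linarith
  have hpow : L ^ (2600 : ℝ) ≤ Real.exp (1 / 16 * L ^ (10 : ℝ)) := hG L hLL₁
  have h10 : L ^ (10 : ℝ) = L ^ 10 := by norm_cast
  rw [h10] at hpow
  calc L ^ (2600 : ℝ) * Real.exp (2 * L ^ 9 + 2) * Real.exp (-(L ^ 20 - 1) ^ 2 / (4 * L ^ 30))
      ≤ Real.exp (1 / 16 * L ^ 10) * Real.exp (2 * L ^ 9 + 2) * Real.exp (-(L ^ 10 / 8)) := by
        gcongr
    _ = Real.exp (1 / 16 * L ^ 10 + (2 * L ^ 9 + 2 + -(L ^ 10 / 8))) := by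
        rw [← Real.exp_add, ← Real.exp_add]; ring_nf
    _ ≤ Real.exp 0 := by
        rw [Real.exp_le_exp]; linarith
    _ = 1 := Real.exp_zero

end Literature.NumberTheory.LFunctions.Zhang2022.Eq1610
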